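import Literature.MathematicalPhysics.QuantumFieldTheory.Balaban1983to89.BlockAveragingEMLLinearised
import Literature.MathematicalPhysics.QuantumFieldTheory.Balaban1983to89.B5Eq112RenormTransf
import HarnessLib

/-!
# Route `UnitScaleTilt`, crux K1 child «MinimiserStabilityRegPr» (stmt-QuantumFields-19200), registered stub `stub_prop7From14` (skeleton birth_v5
# 98cb23610ad7; leaf V3 «Prop 7 from a background (14)») — sub-lemma V3-C, one step at the flat background: **SUP BOUND OF THE EXPLICIT RIGHT
# INVERSE OF THE LINEARISED (0.4)-AVERAGE** (`…Prop7LinAvgOnto.linAvg_rightInverse`): `max_b ‖Y_b‖ ≤ (1 + 2(d+2)L)·max_c ‖Z_c‖`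

Cell `ym3-torus` ∕ fleet seat `ym-ust-19200-p1` (gen 3).  Companion of `UnitScaleTiltProp7LinAvgOnto` ([Balaban1985Variational] (45)–(46): a right
inverse of the linearised averaging WITH `|HB| ≤ B₀|B|`; one step at `U₀ = 1`, so `B₀` may depend on `d`, `L`): the field
`Y = X + d(λ̄_X ∘ blockOf)`, `X = faceField(L⁻¹Z)` (far-face lift, `B5Eq112RenormTransf.faceField`), `λ̄_X = combMean X`
(`BlockAveragingEMLLinearised.combMean`, the block mean of the comb potential along the staircases of (0.3), each of at most `(d+2)L` steps).

WHAT IS PROVED (sorry-free, no definition; [folklore] bookkeeping).  `norm_walkSum_le` (`‖Y(Γ)‖ ≤ |Γ|·max‖Y‖`), `norm_faceField_le`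
(`‖faceField B b‖ ≤ L·max‖B‖`), `norm_combMean_le` (`‖λ̄_Y(y)‖ ≤ (d+2)L·max‖Y‖`), and **`norm_linAvgRightInverse_le`**: every bond value of the
explicit right-inverse image of `Z` has norm `≤ (1 + 2(d+2)L)·M` whenever `‖Z_c‖ ≤ M` for all `c`.

References: T. Bałaban, CMP 102 (1985) 277–309 [Balaban1985Variational] ((45)–(46) p.285); CMP 98 (1985) 17–51 [Balaban1985Averaging] ((62) p.28).
-/

noncomputable section

open scoped BigOperators Matrix.Norms.L2Operator

namespace Summit.QuantumFields.YangMills.Theorems.Prop7LinAvgOnto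

open Literature.MathematicalPhysics.QuantumFieldTheory.Balaban1983to89
open LatticeFieldCalculus BlockAveragingEMLLinearised B5Eq112RenormTransf BlockAveraging

variable {P : Params} {j : ℕ} {n : Type*} [Fintype n] [DecidableEq n]

/-- `‖Y(Γ)‖ ≤ |Γ|·M` if `‖Y_b‖ ≤ M` for all bonds. [folklore] -/
theorem norm_walkSum_le (Y : PBond P j → Matrix n n ℂ) {M : ℝ} (hY : ∀ b, ‖Y b‖ ≤ M) :
    ∀ γ : List (T4Continuum.LStep P j), ‖walkSum Y γ‖ ≤ γ.length * M
  | [] => by simp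
  | s :: γ => by
    rw [walkSum_cons, List.length_cons]
    have ih := norm_walkSum_le Y hY γ
    have hs : ‖(if s.fwd then Y s.bond else -Y s.bond)‖ ≤ M := by
      split_ifs
      · exact hY _
      · rw [norm_neg]; exact hY _
    calc ‖(if s.fwd then Y s.bond else -Y s.bond) + walkSum Y γ‖
        ≤ ‖(if s.fwd then Y s.bond else -Y s.bond)‖ + ‖walkSum Y γ‖ := norm_add_le _ _
      _ ≤ M + γ.length * M := add_le_add hs ih
      _ = ((γ.length + 1 : ℕ) : ℝ) * M := by push_cast; ring

/-- The far-face lift carries `L·B(c)` on the far faces and `0` elsewhere: `‖faceField B b‖ ≤ L·M` if `‖B_c‖ ≤ M` (`M ≥ 0`). [folklore] -/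
theorem norm_faceField_le (B : PBond P (j + 1) → Matrix n n ℂ) {M : ℝ} (hM : 0 ≤ M) (hB : ∀ c, ‖B c‖ ≤ M) (b : PBond P j) :
    ‖faceField B b‖ ≤ (P.L : ℝ) * M := by
  unfold faceField
  split_ifs
  · rw [norm_smul, Real.norm_eq_abs, abs_of_nonneg (Nat.cast_nonneg _)]
    exact mul_le_mul_of_nonneg_left (hB _) (Nat.cast_nonneg _)
  · rw [norm_zero]; positivity

/-- The block mean of the comb potential: `‖λ̄_Y(y)‖ ≤ (d+2)L·M` if `‖Y_b‖ ≤ M` (`M ≥ 0`; staircases have at most `(d+2)L` steps,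
`length_walk_stairWord_le`). [cite: Balaban1985Averaging, (62) p.28] -/
theorem norm_combMean_le (Y : PBond P j → Matrix n n ℂ) {M : ℝ} (hM : 0 ≤ M) (hY : ∀ b, ‖Y b‖ ≤ M) (y : Site P (j + 1)) :
    ‖combMean Y y‖ ≤ ((P.d + 2) * P.L : ℕ) * M := by
  rw [combMean_def]
  have hc : (0 : ℝ) < Fintype.card (Idx P) := Nat.cast_pos.mpr Fintype.card_pos
  have hterm : ∀ i : Idx P, ‖walkSum Y (T4Continuum.walk (emb y) (T4Continuum.stairWord i.2.1 (off i.1)))‖ ≤ ((P.d + 2) * P.L : ℕ) * M := by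
    intro i
    refine (norm_walkSum_le Y hY _).trans ?_
    have hl := length_walk_stairWord_le (emb y) i.2.1 i.1
    exact mul_le_mul_of_nonneg_right (by exact_mod_cast hl) hM
  have hsum : ∑ i : Idx P, ‖walkSum Y (T4Continuum.walk (emb y) (T4Continuum.stairWord i.2.1 (off i.1)))‖
      ≤ ∑ _i : Idx P, ((P.d + 2) * P.L : ℕ) * M := Finset.sum_le_sum fun i _ => hterm i
  rw [Finset.sum_const, Finset.card_univ, nsmul_eq_mul] at hsum
  rw [norm_smul, norm_inv, Complex.norm_natCast, inv_mul_le_iff₀ hc]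
  exact (norm_sum_le _ _).trans hsum

/-- **SUP BOUND OF THE EXPLICIT RIGHT-INVERSE IMAGE**: with `X = faceField(L⁻¹Z)` and `λ = λ̄_X ∘ blockOf`, every bond value of `Y = X + dλ` has
`‖Y_b‖ ≤ (1 + 2(d+2)L)·M` whenever `‖Z_c‖ ≤ M` for all coarse bonds `c` — [Balaban1985Variational] (46) «|HB| ≤ B₀|B|» for this one-step flat `H`
(`B₀ = 1 + 2(d+2)L`). [cite: Balaban1985Variational, (46) p.285] -/
theorem norm_linAvgRightInverse_le (Z : PBond P (j + 1) → Matrix n n ℂ) {M : ℝ} (hM : 0 ≤ M) (hZ : ∀ c, ‖Z c‖ ≤ M) (b : PBond P j) :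
    ‖faceField (fun c' => ((P.L : ℝ)⁻¹) • Z c') b
        + ((fun x : Site P j => combMean (faceField (fun c' => ((P.L : ℝ)⁻¹) • Z c')) (blockOf x)) b.tgt
          - (fun x : Site P j => combMean (faceField (fun c' => ((P.L : ℝ)⁻¹) • Z c')) (blockOf x)) b.src)‖
      ≤ (1 + 2 * ((P.d + 2) * P.L : ℕ)) * M := by
  have hL : (0 : ℝ) < P.L := by exact_mod_cast P.L_pos
  -- `‖L⁻¹Z‖ ≤ L⁻¹M`, so `‖X‖ ≤ M`
  have hZ' : ∀ c, ‖((P.L : ℝ)⁻¹) • Z c‖ ≤ (P.L : ℝ)⁻¹ * M := fun c => by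
    rw [norm_smul, Real.norm_eq_abs, abs_of_nonneg (inv_nonneg.mpr hL.le)]
    exact mul_le_mul_of_nonneg_left (hZ c) (inv_nonneg.mpr hL.le)
  have hX : ∀ b', ‖faceField (fun c' => ((P.L : ℝ)⁻¹) • Z c') b'‖ ≤ M := fun b' => by
    have h0 : (0 : ℝ) ≤ (P.L : ℝ)⁻¹ * M := by positivity
    have h1 : ‖faceField (fun c' => ((P.L : ℝ)⁻¹) • Z c') b'‖ ≤ (P.L : ℝ) * ((P.L : ℝ)⁻¹ * M) :=
      norm_faceField_le (fun c' => ((P.L : ℝ)⁻¹) • Z c') h0 hZ' b'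
    rwa [← mul_assoc, mul_inv_cancel₀ hL.ne', one_mul] at h1
  have hcm : ∀ y, ‖combMean (faceField (fun c' => ((P.L : ℝ)⁻¹) • Z c')) y‖ ≤ ((P.d + 2) * P.L : ℕ) * M :=
    fun y => norm_combMean_le _ hM hX y
  calc _ ≤ ‖faceField (fun c' => ((P.L : ℝ)⁻¹) • Z c') b‖
        + ‖(fun x : Site P j => combMean (faceField (fun c' => ((P.L : ℝ)⁻¹) • Z c')) (blockOf x)) b.tgt
          - (fun x : Site P j => combMean (faceField (fun c' => ((P.L : ℝ)⁻¹) • Z c')) (blockOf x)) b.src‖ := norm_add_le _ _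
    _ ≤ M + (((P.d + 2) * P.L : ℕ) * M + ((P.d + 2) * P.L : ℕ) * M) := by
        refine add_le_add (hX b) ((norm_sub_le _ _).trans (add_le_add (hcm _) (hcm _)))
    _ = (1 + 2 * ((P.d + 2) * P.L : ℕ)) * M := by ring

end Summit.QuantumFields.YangMills.Theorems.Prop7LinAvgOnto

end
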